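import Summits.BirchSwinnertonDyer.BirchSwinnertonDyer.Theses.ErratumRoadFive
import Summits.BirchSwinnertonDyer.BirchSwinnertonDyer.Theorems.ErratumRoadFiveClosesOfThm23SelfDualIrrK
import Summits.BirchSwinnertonDyer.BirchSwinnertonDyer.Theorems.ErratumRoadFiveErratumThm23SelfDualIrrKOfTwoVarCoreThm326
import HarnessLib

/-!
# K2 (route `ErratumRoadFive`, rung K2a, `p ≥ 5`) — the deciding theorem's conclusion FROM THE PRINT-FAITHFUL TWO-VARIABLE CORE S1‡
# ([FW21, Thm. 4.41] at the self-dual twist + App. B Cor. 7.21 ∕ L. 7.22 + the weight-`k` pin + [Hsi14, Thm. B], hypotheses (i) ∕ (iii)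
# AS PRINTED), [Wiles 1988 Thm 2.2] (route item 23081 BY NAME) and the fourteen other binders of `closes` VERBATIM
# (helper, `--supports stmt-BirchSwinnertonDyer-23253 --as helper`; K6 ∘ K3 of `HOME/imc-p1/g26/RAMFREE-REKEY-PROPOSAL.md`, GO-independent)

Cell `bsd-stepL` (run/shared/lean/pub/bsd-stepL/), seat `bsd-stepL-imc-p1` (prover g31, 2026-08-29). Theorems only (no definition, no
named fact, no `sorry`, no instance, no notation; the S1‡ hypothesis is a section `variable`, stated ONCE). This module imports the route
file (conclusions are route decls ∕ the rung leaf by name), so no `_holds` link can be stated here. It composes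

* imc-p1 g31's ‡ CHAIN `ErratumChainSelfDualIrrK.erratumThm23SigmaLeSelfDualIrrK_OPEN_of_twoVarCoreIrrK_of_thm326`
  (S1‡ + [W] ⟹ F4♯‡ `Castella2018.erratumThm23_charIdeal_sigma_le_of_isTorsion_selfDual_irrK_OPEN`), with
* imc-p1 g30's ‡ CONSUMER ∕ `closes` rehearsal `RekeyIrrK.*_of_thm23SelfDualIrrK_OPEN_of_items` (F4♯‡ + items ⟹ 20169 ∕ 19061 ∕ the leaf).

## What this file proves (all BY NAME, all CONDITIONAL)

* `erratumThm23SigmaLeSelfDualIrrK_OPEN_of_FW21IrrK_of_item` — F4♯‡ from S1‡ and the route ITEM 23081 `HidaOrdinaryUnitRootFact`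
  (which unfolds definitionally to `Hida2000_thm326_ordinary_unitRoot`): the `_of` of the twin line `Lines/erratum_chain_irrK.lean`
  (turnkey `HOME/imc-p1/g31/`, NOT keyed — W-79) for the twin crux `ErratumThm23SigmaLeSelfDualIrrK := F4♯‡` of the RAMFREE re-key,
  should the planner mint it (RULING 86 (c): recorded, not applied; this file applies nothing).
* `imcDivAtErratumDataAllR_of_FW21IrrK_of_items` — aside 20169 `IMCDivAtErratumDataAllR` from S1‡ + 23081 + 23050 + 20495 + 19283.
* `openInputIMC_of_FW21IrrK_of_items` — the parent 19061 `OpenInputIMC` from S1‡ + 23081 + seven route items.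
* `multiplicativeRankOne_of_FW21IrrK_of_items` — **the rung-K2a leaf `X11b.MultiplicativeRankOne` from S1‡, 23081 and the fourteen
  other binders of `Theses.ErratumRoadFive.closes` (rev 71) VERBATIM.**

So the OPEN input of rung K2a along the (ram) road is displayed, kernel-checked, in its PRINT-FAITHFUL currency: ONE statement S1‡ about
ONE crystalline `p`-ordinary newform `g` over `K` — [FW21, Thm. 4.41] bullets 1–3 («`ρ̄_f|G_𝒦` (absolutely) irreducible», «`p` split»,
«∃ `q ∥ N` not split in `𝒦`») with App. B Cor. 7.21 ∕ L. 7.22, the weight-`k` analogue of [CGS25, Prop. 2.4.5] (the pin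
`constantCoeff Q₂ = u • Q` on `T_c = 0`) and [Hsi14, Thm. B] — and no longer through its (ram)-specialisation S1† (footnote-1 form (i′)).
DIRECTION OF STRENGTH: S1‡ has weaker hypotheses than S1†, hence is the (slightly) STRONGER open claim — exactly the printed one; on the
(ram) road both give the same theorems ((i) holds at every Hida member by imc-p1 g27's `SurjIrrK` bridge, used inside g30's consumer).

HONEST FRAMING: CONDITIONAL theorems — S1‡ is OPEN ∕ PRE (unrefereed arXiv:2107.13726 Thm. 4.41 + Castella's unrefereed erratum + the
unprinted weight-`k` CGS computation); 23081 is a printed theorem taken BY NAME; the other binders are route items (several open);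
nothing is booked; no item closes; the anticyclotomic main conjecture is asserted nowhere; BSD is proved for no pair; closes: none (T7).

References: [FouquetWan2021] Thm. 4.41, App. B Cor. 7.21, L. 7.22 (PREPRINT); [Castella2018Erratum] Thm. 1.1, Thm. 2.3 (i)–(iv),
(2.4)–(2.5), footnote 1 (pp. 1–4); [Wiles1988] Thm. 2.2; [JetchevSkinnerWan2017] §3.4, §5.1; [CastellaGrossiSkinner2025] Prop. 2.4.5;
[Hsieh2014] Thm. B; [Castella2018Exceptional] Thms. 2.10–2.11; [Wuthrich2014] Prop. 21.
[claim: FouquetWan2021, Thm. 4.41, App. B Cor. 7.21, Lemma 7.22, status: under-review] [claim: Castella2018Erratum, Thm. 2.3, status: under-review]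

REPAIR (imc-p1 g35, 2026-08-29; referee g75 GAP of VERDICT-RULING107-FOURWAY-g75.md; ops-buildfix drift read d0840): ER5 rev 73
(RULING 107 B1) REMOVED the route def `ErratumHidaMemberFramesNonsplitWt` (:= F3♯†
`Castella2018.erratum_exists_frames_members_sigma_congruence_nonsplit_wt`), which three theorems below bind by short name. Repair
WITHOUT touching a declaration, jointly with the same repair of the imported `ErratumRoadFiveClosesOfThm23SelfDualIrrK`: the short
name is re-bound by an `open … renaming` to the Literature decl it unfolded to. Every declaration is byte-identical with p691780 and
elaborates to the same statement. What the file certifies is unchanged: a spent rehearsal — RULING 107 has since minted the twin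
crux 24211 with line `erratum_chain` v1‡ on the ♭-pinned stub S1♭‡ (see `ErratumRoadFiveErratumThm23SelfDualIrrKOfTwoVarCoreDivPin`).
-/

set_option autoImplicit false
-- D-0017: single-problem summit, the namespace repeats the problem name by design.
set_option linter.dupNamespace false

noncomputable section

open scoped Classical
open PowerSeries NumberField IsDedekindDomain Field
  Literature.NumberTheory.EllipticCurves Literature.NumberTheory.EllipticCurves.ModularForms
  Literature.NumberTheory.EllipticCurves.BigGaloisRep Literature.NumberTheory.EllipticCurves.GreenbergSelmer
  Literature.NumberTheory.GaloisRepresentations Literature.NumberTheory.EllipticCurves.Castella2018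
open Summit.BirchSwinnertonDyer.BirchSwinnertonDyer.Theses.ErratumRoadFive
-- REPAIR (imc-p1 g35): the binder type `ErratumHidaMemberFramesNonsplitWt` of three theorems below was the route def of item
-- 23254 (:= F3♯†), removed from `Theses.ErratumRoadFive` by rev 73 (RULING 107 B1); the short name is re-bound here to the
-- Literature decl it unfolded to, so every declaration stays byte-identical (gate append-only rule) and elaborates as before.
open Literature.NumberTheory.EllipticCurves.Castella2018
  renaming erratum_exists_frames_members_sigma_congruence_nonsplit_wt → ErratumHidaMemberFramesNonsplitWt

namespace Summit.BirchSwinnertonDyer.BirchSwinnertonDyer.Theorems.RekeyIrrK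

section FW21IrrK

/-! ### The print-faithful two-variable core S1‡ as a section hypothesis (stated once; = binder `hFW` of
`ErratumChainSelfDualIrrK.erratumThm23SigmaLeSelfDualIrrK_OPEN_of_twoVarCoreIrrK_of_thm326`, i.e. S1† of line `erratum_chain` v3‡ with
exactly its (i′) block replaced by the printed (i) ∕ (iii)) -/

set_option maxHeartbeats 400000 -- buildfix (bf3-g42): the `variable` binder type below needs > 180k to elaborate (`set_option … in` cannot scope a `variable`); restored to 200000 right after the block
variable
    (hFW :
    ∀ {p : ℕ} [Fact p.Prime] (ι : PadicAlgCl p ≃+* ℂ) {M : ℕ} [NeZero M] {k : ℤ}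
      (g : CuspForm (CongruenceSubgroup.Gamma0 M) k) (ιg : coeffField g →+* PadicAlgCl p)
      (Δ : OrdinaryNewformDatum g p ιg)
      (K : Type) [Field K] [NumberField K] (𝔭 𝔭bar : HeightOneSpectrum (𝓞 K)) (κ : ZpExtension K p)
      (γ : absoluteGaloisGroup K) [Fact (κ.IsTopGenerator γ)] (S : Finset (HeightOneSpectrum (𝓞 K))),
      IsNewform0 g → 2 ≤ k → Even k → 3 ≤ M → ¬ p ∣ M → 3 < p →
      (∀ x : coeffField g, ι (ιg x) = (x : ℂ)) →
      ‖ιg ⟨(UpperHalfPlane.qExpansion 1 ⇑g).coeff p, coeff_mem_coeffField g p⟩‖ = 1 →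
      IsImaginaryQuadratic K → (∃ β : ℤ, (4 * M : ℤ) ∣ β ^ 2 - NumberField.discr K) →
      ((Ideal.span {(p : ℤ)}).primesOver (𝓞 K)).ncard = 2 →
      ((p : ℕ) : 𝓞 K) ∈ 𝔭.asIdeal →
      (∀ (w : InfinitePlace K) (x : 𝓞 K), x ∈ 𝔭.asIdeal ↔ ‖ι.symm (w.embedding (x : K))‖ < 1) →
      ((p : ℕ) : 𝓞 K) ∈ 𝔭bar.asIdeal → 𝔭bar ≠ 𝔭 →
      -- (i) AS PRINTED: `ρ̄_g|_{G_K}` irreducible (erratum Thm. 2.3 (i); [FW21, Thm. 4.41] first bullet)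
      IsSimpleOrder (Subrepresentation
        ((SkinnerUrban2014.residualRep Δ).comp (absGaloisRestrict ℚ K : absoluteGaloisGroup K →* absoluteGaloisGroup ℚ))) →
      -- (iii) AS PRINTED: some prime `q ∥ M` is non-split in `K` (erratum Thm. 2.3 (iii); [FW21, Thm. 4.41] third bullet)
      (∃ q : ℕ, q.Prime ∧ q ∣ M ∧ ¬ q ^ 2 ∣ M ∧ ((Ideal.span {(q : ℤ)}).primesOver (𝓞 K)).ncard ≠ 2) →
      (((Ideal.span {(2 : ℤ)}).primesOver (𝓞 K)).ncard ≠ 2 → (2 ∣ M ∧ ¬ 4 ∣ M)) →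
      (∀ ℓ : ℕ, ℓ.Prime → ℓ ∣ M → ((Ideal.span {(ℓ : ℤ)}).primesOver (𝓞 K)).ncard ≠ 2 →
        ¬ ℓ ^ 2 ∣ M ∧ (UpperHalfPlane.qExpansion 1 ⇑g).coeff ℓ = -((ℓ : ℂ) ^ (k / 2 - 1).toNat)) →
      κ.IsAnticyclotomic → (∀ w ∈ S, ((p : ℕ) : 𝓞 K) ∉ w.asIdeal) →
      (∀ w : HeightOneSpectrum (𝓞 K), ((M : ℕ) : 𝓞 K) ∈ w.asIdeal → w ∈ S) →
      ∀ (b : padicCoeffIntegers ιg →+* PadicComplexInt p),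
        (∀ x, ((b x : PadicComplexInt p) : ℂ_[p]) =
          algebraMap (PadicAlgCl p) ℂ_[p] (padicCoeffIntegers.toPadicAlgCl ιg x)) →
      ∀ (ΩK : ℂ) (Ωp : (PadicComplexInt p)ˣ) (Q : PowerSeries (PadicComplexInt p)), ΩK ≠ 0 →
        IsBDPLFunctionWtSigmaInt ι 𝔭 κ γ g S ΩK ((Ωp : PadicComplexInt p) : ℂ_[p]) Q →
      -- the complementary (cyclotomic) direction `κ'` with generator `γ'`: `Γ_K = Γ⁺ ⊕ Γ⁻ ≅ ℤ_p²` for `p` odd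
      ∀ (κ' : ZpExtension K p) (γ' : absoluteGaloisGroup K) [Fact (κ'.IsTopGenerator γ')], κ'.IsCyclotomic →
      ∀ [TopologicalSpace (PowerSeries (padicCoeffIntegers ιg))]
        [TopologicalSpace (PowerSeries (PowerSeries (padicCoeffIntegers ιg)))]
        [ContinuousSMul (PowerSeries (PowerSeries (padicCoeffIntegers ιg)))
          (BigRepModule (PowerSeries (padicCoeffIntegers ιg)) p
            (BigRepModule (padicCoeffIntegers ιg) p (Cofree Δ.selfDualRep (padicCoeffField ιg))))],
      -- premise: `X^Σ_K(A_g)` is `Λ_K`-torsion; conclusion: a two-variable frame pinned to `Q` on `X = 0` dividing `Ch_{Λ_K}(X^Σ_K(A_g))`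
      Module.IsTorsion (PowerSeries (PowerSeries (padicCoeffIntegers ιg)))
          (XBig κ' (AnticyclotomicBigGaloisRep κ (Δ.selfDualCofreeRepOver K)) 𝔭bar (↑S)) →
      ∃ Q₂ : PowerSeries (PowerSeries (PadicComplexInt p)),
        (∃ u : (PowerSeries (PadicComplexInt p))ˣ,
            PowerSeries.constantCoeff Q₂ = (u : PowerSeries (PadicComplexInt p)) * Q) ∧
        (XBig.charIdeal κ' (AnticyclotomicBigGaloisRep κ (Δ.selfDualCofreeRepOver K)) 𝔭bar (↑S)).map
            (PowerSeries.map (PowerSeries.map b)) ≤ Ideal.span {Q₂} )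
    (hW : HidaOrdinaryUnitRootFact)

set_option maxHeartbeats 200000 -- buildfix (bf3-g42): back to the default after the section hypothesis
include hFW hW

set_option maxHeartbeats 400000 in
/-- **F4♯‡ ⟸ S1‡ + route item 23081** — `ErratumChainSelfDualIrrK.erratumThm23SigmaLeSelfDualIrrK_OPEN_of_twoVarCoreIrrK_of_thm326` with
the named fact [Wiles88 Thm. 2.2] taken as the route ITEM `HidaOrdinaryUnitRootFact` (aside 23081; unfolds definitionally): the `_of` of the
twin line `erratum_chain_irrK` for the twin crux `ErratumThm23SigmaLeSelfDualIrrK := F4♯‡`, were it minted. CONDITIONAL (S1‡ OPEN); nothing booked.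
[cite: Castella2018Erratum, Thm. 2.3 (i), (iii), proof (2.4) ⇒ (2.5) (pp. 3–4)] [cite: Wiles1988, Thm. 2.2] -/
theorem erratumThm23SigmaLeSelfDualIrrK_OPEN_of_FW21IrrK_of_item :
    erratumThm23_charIdeal_sigma_le_of_isTorsion_selfDual_irrK_OPEN :=
  ErratumThm23TwoVariable.ErratumChainSelfDualIrrK.erratumThm23SigmaLeSelfDualIrrK_OPEN_of_twoVarCoreIrrK_of_thm326 hFW hW

set_option maxHeartbeats 400000 in
/-- **Aside 20169 `IMCDivAtErratumDataAllR` BY NAME from S1‡ + 23081 + three route ITEMS** (23050 `ErratumHidaMemberFramesNonsplitWt`,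
20495 `JSWSigmaLocalCharIdeal`, 19283 `PublishedInputsIMCReduction`): g30's `imcDivAtErratumDataAllR_of_thm23SelfDualIrrK_OPEN_of_items`
after the ‡ chain. CONDITIONAL; nothing booked. [cite: Castella2018Erratum, Thm. 2.3, (2.4)–(2.5) and proof of Thm. 1.1 (pp. 3–4)]
[cite: JetchevSkinnerWan2017, §5.1] -/
theorem imcDivAtErratumDataAllR_of_FW21IrrK_of_items
    (hMF : ErratumHidaMemberFramesNonsplitWt) (hloc : JSWSigmaLocalCharIdeal) (hF : PublishedInputsIMCReduction) :
    IMCDivAtErratumDataAllR :=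
  imcDivAtErratumDataAllR_of_thm23SelfDualIrrK_OPEN_of_items
    (ErratumThm23TwoVariable.ErratumChainSelfDualIrrK.erratumThm23SigmaLeSelfDualIrrK_OPEN_of_twoVarCoreIrrK_of_thm326 hFW hW)
    hMF hloc hF

set_option maxHeartbeats 400000 in
/-- **The parent 19061 `OpenInputIMC` BY NAME from S1‡ + 23081 + seven route ITEMS** (23050, 20495, 19283, 19625 `BDPValueContinuityInput`,
19285 `WuthrichShaDividesAnalyticSha`, 19624 `RamNoErratumDataAtFive`, 19282 `OpenInputNotRam`): «[FW21 4.41] for ONE newform with the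
PRINTED hypotheses → published member data → … → `P2OpenInputOnTreeAt` at every X11b pair, `p ≥ 5`», modulo the residual cruxes REST‴ ∕ ¬ram.
g30's `openInputIMC_of_thm23SelfDualIrrK_OPEN_of_items` after the ‡ chain. CONDITIONAL; nothing booked.
[cite: Castella2018Erratum, Thm. 1.1, Thm. 2.3 and proof (pp. 1–4)] [cite: Castella2018Exceptional, Thms. 2.10–2.11] [cite: Wuthrich2014, Prop. 21] -/
theorem openInputIMC_of_FW21IrrK_of_items
    (hMF : ErratumHidaMemberFramesNonsplitWt) (hloc : JSWSigmaLocalCharIdeal) (hF : PublishedInputsIMCReduction)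
    (hVN : BDPValueContinuityInput) (hWu : WuthrichShaDividesAnalyticSha) (hrest : RamNoErratumDataAtFive)
    (hOff : OpenInputNotRam) : OpenInputIMC :=
  openInputIMC_of_thm23SelfDualIrrK_OPEN_of_items
    (ErratumThm23TwoVariable.ErratumChainSelfDualIrrK.erratumThm23SigmaLeSelfDualIrrK_OPEN_of_twoVarCoreIrrK_of_thm326 hFW hW)
    hMF hloc hF hVN hWu hrest hOff

set_option maxHeartbeats 400000 in
/-- **The rung-K2a leaf `X11b.MultiplicativeRankOne` from S1‡, route item 23081, and the fourteen OTHER binders of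
`Theses.ErratumRoadFive.closes` (rev 71) VERBATIM** (`hMF hloc hrest hOff hF hVN hRes h₃ h₄ h₅ hJL hCO hCTi hESi`): g30's
`multiplicativeRankOne_of_thm23SelfDualIrrK_OPEN_of_items` (= `closes` with `h23 : F4♯‡`) after the ‡ chain. K2a's open input on the
(ram) road in print-faithful currency. CONDITIONAL on every binder (S1‡ OPEN ∕ PRE); BSD is proved for no pair.
[cite: FouquetWan2021, Thm. 4.41 (arXiv:2107.13726 pp. 44–45)] [cite: Castella2018Erratum, Thm. 1.1, Thm. 2.3 (pp. 1–4)]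
[cite: Wiles1988, Thm. 2.2] [cite: Castella2018Exceptional, Thms. 2.10–2.11] [cite: Wuthrich2014, Prop. 21] -/
theorem multiplicativeRankOne_of_FW21IrrK_of_items
    (hMF : ErratumHidaMemberFramesNonsplitWt)
    (hloc : JSWSigmaLocalCharIdeal)
    (hrest : RamNoErratumDataAtFive) (hOff : OpenInputNotRam)
    (hF : PublishedInputsIMCReduction) (hVN : BDPValueContinuityInput)
    (hRes : EulerHalfNotRamNoInertSetAtFive) (h₃ : X11aLowerHalf) (h₄ : NonSurjCorner)
    (h₅ : PublishedInputsFive) (hJL : ShimuraParametrizationDataNonempty) (hCO : PastenComponentOrdersInput)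
    (hCTi : ShimuraCasselsTateLevelInputs) (hESi : ShimuraHeegnerEulerSystemInertPrintedR) :
    Summit.BirchSwinnertonDyer.Rank1Residual.X11b.MultiplicativeRankOne :=
  multiplicativeRankOne_of_thm23SelfDualIrrK_OPEN_of_items
    (ErratumThm23TwoVariable.ErratumChainSelfDualIrrK.erratumThm23SigmaLeSelfDualIrrK_OPEN_of_twoVarCoreIrrK_of_thm326 hFW hW)
    hMF hloc hrest hOff hF hVN hRes h₃ h₄ h₅ hJL hCO hCTi hESi

end FW21IrrK

end Summit.BirchSwinnertonDyer.BirchSwinnertonDyer.Theorems.RekeyIrrK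

end
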